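import Mathlib
import Literature.NumberTheory.LFunctions.Zhang2022.Section15BEq1515Core
import Literature.NumberTheory.LFunctions.Zhang2022.Section15BEq1515Residues
import Literature.NumberTheory.LFunctions.Zhang2022.Section7ZetaNearOne
import Literature.NumberTheory.LFunctions.Zhang2022.Section16Eq1610Bounds
import HarnessLib

/-!
# Zhang (2022) §15 (15.15)–(15.16): the residue side of the contour shift at the lane's objects —
# the three residues are `ℛ_{1j}d^{β_j}ℳ₁(d,l;1−β_j)`, and the residue at `ρ̃ − 1` is small

Topic `Literature/NumberTheory/LFunctions/Zhang2022` (Landau–Siegel audit tree; verdict-neutral).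
Y. Zhang, *Discrete mean estimates and the Landau–Siegel zero*, arXiv:2211.02515v1 (2022)
[Zhang2022LandauSiegel] — **an unrefereed manuscript under adjudication**; nothing here is a claim of
the manuscript. Display (15.15) [Z22 p.85, tex L4218–4224]: "In a way similar to the proof of Lemma 8.4,
we deduce that `𝒟₁(d,l) = λ₁(d)Σ_{j≤3}ℛ_{1j}d^{β_j}ℳ₁(d,l;1−β_j) + O(ε₁)`, where `ℛ_{1j}` denotes the
residue of the function (15.16) at `s = −β_j` … (15.16) also has a simple pole at `s = ρ̃ − 1`, while
the residue at this point can be regarded as an acceptable error."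

The tree's contour core `Eq1515.core` (`Section15BEq1515Core`, zl-w15-p1) is ABSTRACT in the
Euler-product factor `M`, the constant `c`, the shifts `β_a, β_b, β`, the length `Y` and the Gaussian
parameter `Λ`; its output is the sum of four explicit residue terms. THIS FILE instantiates the
residue terms at the objects of §15 — `M := ℳ₁(d,l;·)` (`Typed.Section15B.calM1`), `c := d^{β₃}`,
`β_a, β_b, β := β₁, β₂, β₃`, `Y := P₄/d`, `Λ := 𝓛³⁰` — and proves:

* `resA_eq_calR1_one`, `resB_eq_calR1_two`, `resK_eq_calR1_three` — the residues at `−β₁, −β₂, −β₃`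
  ARE `ℛ_{1j}·d^{β_j}·ℳ₁(d,l;1−β_j)` (`j = 1, 2, 3`), with `ℛ_{1j} = Typed.Section15B.calR1 c′ χ j`
  the typed residue of (15.16) (evaluated in `Section15BEq1515Residues`; the only arithmetic is
  `d^{β₃}(P₄/d)^{β₃−β_j} = P₄^{β₃−β_j}d^{β_j}`);
* `norm_resRho_1515_le` — the residue at the exceptional zero, "an acceptable error": with the per-`D`
  output of `Lemma84.exceptional_package` for `ρ = ρ̃` (simple real zero, and the bound
  `‖L(s,χ)⁻¹‖ ≤ C(log D + log(|Im s|+4))(1 + |s−ρ̃|⁻¹)` right of `1 − c/(…)`) and `α/2 ≤ |β_j| ≤ 1`,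
  its norm is at most `C_ρ·(C+1)(log D + log 4)·α⁻³·(1 − ρ̃)·M_M` (`‖ℳ₁(d,l;ρ̃)‖ ≤ M_M`), i.e.
  `≪ 𝓛²⁸(1 − ρ̃)·M_M ≪ 𝓛^{28−2022}·W(d,l)` under (A) — polynomially, not exponentially, small (the lane's
  reading of record of "acceptable", zl-libC-p2 advisory). The inputs discharged here: `ζ` near its
  pole (`ZetaNearOne.exists_bound_riemannZeta_rect`, `ZetaClassicalRegion.exists_bound_sub_inv_rect`
  for `|ζ₁(ρ̃)| ≥ 1/2`) and `‖L′(ρ̃,χ)⁻¹‖ ≤ (C+1)(log D + log 4)` (`Eq1610.norm_inv_deriv_le_of_inv_bound`).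

Helper theorems under leaf h15_17 (`Typed.Section15B.Eq15_17`), consumed by zl-w15-p1's assembly
`Section15BEq1515Ranged` (the (15.15)W statement of record). Theorems only; 0 definitions; standard
axioms. Nothing about Landau–Siegel zeros or the manuscript's Theorems 1–2 is asserted.

## References
* Y. Zhang, arXiv:2211.02515v1 (2022), §15 (15.15)–(15.16) p.85. [cite: Zhang2022LandauSiegel, §15 (15.15)]
* H. L. Montgomery, R. C. Vaughan, *Multiplicative Number Theory I*, CUP 2007, Thm 11.4.
  [cite: MontgomeryVaughan2007, Thm 11.4]
-/

noncomputable section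

open Complex Real Set Filter Topology

namespace Literature.NumberTheory.LFunctions.Zhang2022.Eq1515

open Literature.NumberTheory.LFunctions.Zhang2022.Skeleton
open Literature.NumberTheory.LFunctions.Zhang2022.GaussWeight
open Literature.NumberTheory.LFunctions.Zhang2022.Typed.Section15A
open Literature.NumberTheory.LFunctions.Zhang2022.Typed.Section15B

variable (c' : ℝ) {D : ℕ} [NeZero D] (χ : DirichletCharacter ℂ D)

/-! ### Arithmetic of the length `Y = P₄/d` and the constant `c = d^{β₃}` -/

omit [NeZero D] in
/-- `(P₄/d)^{w} = P₄^{w}/d^{w}` (`d ≥ 1`, `P₄ > 0`). [folklore] -/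
private theorem P4_div_cpow {d : ℕ} (hd : 1 ≤ d) (hP : 0 < P4 D) (w : ℂ) :
    ((P4 D / d : ℝ) : ℂ) ^ w = (P4 D : ℂ) ^ w / (d : ℂ) ^ w := by
  have hd0 : (0 : ℝ) < d := by exact_mod_cast hd
  have h := div_cpow_line (X := P4 D) hP hd0 w
  simpa using h

omit [NeZero D] in
/-- `d^{β₃}·(P₄/d)^{β₃−β} = P₄^{β₃−β}·d^{β}` (`d ≥ 1`, `P₄ > 0`). [folklore] -/
private theorem cst_mul_Y_cpow {d : ℕ} (hd : 1 ≤ d) (hP : 0 < P4 D) (β : ℂ) :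
    (d : ℂ) ^ beta3 c' D * ((P4 D / d : ℝ) : ℂ) ^ (beta3 c' D - β) =
      (P4 D : ℂ) ^ (beta3 c' D - β) * (d : ℂ) ^ β := by
  have hd0 : (0 : ℝ) < d := by exact_mod_cast hd
  have hdC : (d : ℂ) ≠ 0 := by exact_mod_cast hd0.ne'
  rw [P4_div_cpow hd hP, Complex.cpow_sub _ _ hdC]
  have h3 : (d : ℂ) ^ beta3 c' D ≠ 0 := by
    rw [Ne, Complex.cpow_eq_zero_iff]; exact fun h => hdC h.1
  have hβ : (d : ℂ) ^ β ≠ 0 := by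
    rw [Ne, Complex.cpow_eq_zero_iff]; exact fun h => hdC h.1
  field_simp

/-! ### The residues at `−β₁, −β₂, −β₃` are `ℛ_{1j}·d^{β_j}·ℳ₁(d,l;1−β_j)` -/

/-- **Residue at `−β₁`** = `ℛ₁₁·d^{β₁}·ℳ₁(d,l;1−β₁)`: the `j = 1` term of (15.15). The left side is
the `−β_a`-residue term of `Eq1515.core` at `M := ℳ₁(d,l;·)`, `c := d^{β₃}`, `β_a := β₁`, `β_b := β₂`,
`β := β₃`, `Y := P₄/d`, `Λ := 𝓛³⁰`. [cite: Zhang2022LandauSiegel, §15 (15.15)–(15.16) p.85] -/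
theorem resA_eq_calR1_one (hχ1 : χ ≠ 1) (hP : 0 < P4 D) {d : ℕ} (hd : 1 ≤ d) (l : ℕ)
    (h10 : beta1 c' D ≠ 0) (h12 : beta1 c' D ≠ beta2 c' D) (h13 : beta1 c' D ≠ beta3 c' D)
    (hζ : riemannZeta (1 - beta1 c' D) ≠ 0) (hL : χ.LFunction (1 - beta1 c' D) ≠ 0) :
    riemannZeta₁ (1 + -beta1 c' D + beta1 c' D) * riemannZeta (1 + -beta1 c' D + beta2 c' D) *
        (calM1 c' χ d l (1 + -beta1 c' D) * (d : ℂ) ^ beta3 c' D * -beta1 c' D /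
          (riemannZeta₁ (1 + -beta1 c' D) * χ.LFunction (1 + -beta1 c' D))) *
        (((P4 D / d : ℝ) : ℂ) ^ (-beta1 c' D + beta3 c' D) *
          omega1 (ell D ^ 30) (-beta1 c' D + beta3 c' D)) / (-beta1 c' D + beta3 c' D) =
      calR1 c' χ 1 * (d : ℂ) ^ beta1 c' D * calM1 c' χ d l (1 - beta1 c' D) := by
  rw [resA_eq χ (calM1 c' χ d l) ((d : ℂ) ^ beta3 c' D) (beta1 c' D) (beta2 c' D) (beta3 c' D)
      (P4 D / d) (ell D ^ 30) h10 hζ hL,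
    calR1_one_eq c' χ hχ1 hP h10 h12 h13 hζ hL]
  have key := cst_mul_Y_cpow c' hd hP (beta1 c' D)
  set A := riemannZeta (1 - beta1 c' D + beta2 c' D) /
    (riemannZeta (1 - beta1 c' D) * χ.LFunction (1 - beta1 c' D)) with hA
  calc A * (calM1 c' χ d l (1 - beta1 c' D) * (d : ℂ) ^ beta3 c' D) *
        (((P4 D / d : ℝ) : ℂ) ^ (beta3 c' D - beta1 c' D) *
          omega1 (ell D ^ 30) (beta3 c' D - beta1 c' D) / (beta3 c' D - beta1 c' D))
      = A * calM1 c' χ d l (1 - beta1 c' D) *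
          (((d : ℂ) ^ beta3 c' D * ((P4 D / d : ℝ) : ℂ) ^ (beta3 c' D - beta1 c' D)) *
            omega1 (ell D ^ 30) (beta3 c' D - beta1 c' D) / (beta3 c' D - beta1 c' D)) := by ring
    _ = A * calM1 c' χ d l (1 - beta1 c' D) *
          (((P4 D : ℂ) ^ (beta3 c' D - beta1 c' D) * (d : ℂ) ^ beta1 c' D) *
            omega1 (ell D ^ 30) (beta3 c' D - beta1 c' D) / (beta3 c' D - beta1 c' D)) := by
        rw [key]
    _ = A * ((P4 D : ℂ) ^ (beta3 c' D - beta1 c' D) *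
          omega1 (ell D ^ 30) (beta3 c' D - beta1 c' D) / (beta3 c' D - beta1 c' D)) *
          (d : ℂ) ^ beta1 c' D * calM1 c' χ d l (1 - beta1 c' D) := by ring

/-- **Residue at `−β₂`** = `ℛ₁₂·d^{β₂}·ℳ₁(d,l;1−β₂)`: the `j = 2` term of (15.15) (the `−β_b`-residue
term of `Eq1515.core` at the same instantiation). [cite: Zhang2022LandauSiegel, §15 (15.15)–(15.16) p.85] -/
theorem resB_eq_calR1_two (hχ1 : χ ≠ 1) (hP : 0 < P4 D) {d : ℕ} (hd : 1 ≤ d) (l : ℕ)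
    (h20 : beta2 c' D ≠ 0) (h21 : beta2 c' D ≠ beta1 c' D) (h23 : beta2 c' D ≠ beta3 c' D)
    (hζ : riemannZeta (1 - beta2 c' D) ≠ 0) (hL : χ.LFunction (1 - beta2 c' D) ≠ 0) :
    riemannZeta₁ (1 + -beta2 c' D + beta2 c' D) * riemannZeta (1 + -beta2 c' D + beta1 c' D) *
        (calM1 c' χ d l (1 + -beta2 c' D) * (d : ℂ) ^ beta3 c' D * -beta2 c' D /
          (riemannZeta₁ (1 + -beta2 c' D) * χ.LFunction (1 + -beta2 c' D))) *
        (((P4 D / d : ℝ) : ℂ) ^ (-beta2 c' D + beta3 c' D) *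
          omega1 (ell D ^ 30) (-beta2 c' D + beta3 c' D)) / (-beta2 c' D + beta3 c' D) =
      calR1 c' χ 2 * (d : ℂ) ^ beta2 c' D * calM1 c' χ d l (1 - beta2 c' D) := by
  rw [resA_eq χ (calM1 c' χ d l) ((d : ℂ) ^ beta3 c' D) (beta2 c' D) (beta1 c' D) (beta3 c' D)
      (P4 D / d) (ell D ^ 30) h20 hζ hL,
    calR1_two_eq c' χ hχ1 hP h20 h21 h23 hζ hL]
  have key := cst_mul_Y_cpow c' hd hP (beta2 c' D)
  set A := riemannZeta (1 - beta2 c' D + beta1 c' D) /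
    (riemannZeta (1 - beta2 c' D) * χ.LFunction (1 - beta2 c' D)) with hA
  calc A * (calM1 c' χ d l (1 - beta2 c' D) * (d : ℂ) ^ beta3 c' D) *
        (((P4 D / d : ℝ) : ℂ) ^ (beta3 c' D - beta2 c' D) *
          omega1 (ell D ^ 30) (beta3 c' D - beta2 c' D) / (beta3 c' D - beta2 c' D))
      = A * calM1 c' χ d l (1 - beta2 c' D) *
          (((d : ℂ) ^ beta3 c' D * ((P4 D / d : ℝ) : ℂ) ^ (beta3 c' D - beta2 c' D)) *
            omega1 (ell D ^ 30) (beta3 c' D - beta2 c' D) / (beta3 c' D - beta2 c' D)) := by ring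
    _ = A * calM1 c' χ d l (1 - beta2 c' D) *
          (((P4 D : ℂ) ^ (beta3 c' D - beta2 c' D) * (d : ℂ) ^ beta2 c' D) *
            omega1 (ell D ^ 30) (beta3 c' D - beta2 c' D) / (beta3 c' D - beta2 c' D)) := by
        rw [key]
    _ = A * ((P4 D : ℂ) ^ (beta3 c' D - beta2 c' D) *
          omega1 (ell D ^ 30) (beta3 c' D - beta2 c' D) / (beta3 c' D - beta2 c' D)) *
          (d : ℂ) ^ beta2 c' D * calM1 c' χ d l (1 - beta2 c' D) := by ring

/-- **Residue at `−β₃`** (the kernel's pole) = `ℛ₁₃·d^{β₃}·ℳ₁(d,l;1−β₃)`: the `j = 3` term of (15.15)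
(the `−β`-residue term `Φ(−β)·Y⁰ω₁(0)` of `Eq1515.core`, `Φ` the regularised first factor at the
same instantiation). [cite: Zhang2022LandauSiegel, §15 (15.15)–(15.16) p.85] -/
theorem resK_eq_calR1_three {Φ : ℂ → ℂ} (hχ1 : χ ≠ 1) (hP : 0 < P4 D) (d l : ℕ)
    (hΦ : ∀ s, Φ s = riemannZeta (1 + s + beta1 c' D) * riemannZeta (1 + s + beta2 c' D) *
      calM1 c' χ d l (1 + s) * (d : ℂ) ^ beta3 c' D * s /
      (riemannZeta₁ (1 + s) * χ.LFunction (1 + s)))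
    (h30 : beta3 c' D ≠ 0) (h31 : beta3 c' D ≠ beta1 c' D) (h32 : beta3 c' D ≠ beta2 c' D)
    (hζ : riemannZeta (1 - beta3 c' D) ≠ 0) (hL : χ.LFunction (1 - beta3 c' D) ≠ 0) :
    Φ (-beta3 c' D) * (((P4 D / d : ℝ) : ℂ) ^ (-beta3 c' D + beta3 c' D) *
        omega1 (ell D ^ 30) (-beta3 c' D + beta3 c' D)) =
      calR1 c' χ 3 * (d : ℂ) ^ beta3 c' D * calM1 c' χ d l (1 - beta3 c' D) := by
  rw [resBeta_eq χ Φ (calM1 c' χ d l) ((d : ℂ) ^ beta3 c' D) (beta1 c' D) (beta2 c' D) (beta3 c' D)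
      (P4 D / d) (ell D ^ 30) h30 hΦ,
    calR1_three_eq c' χ hχ1 hP h30 h31 h32 hζ hL]
  ring

/-- The three residues together: the main term of (15.15) without the factor `λ₁(d)`,
`Σ_{j≤3} ℛ_{1j}d^{β_j}ℳ₁(d,l;1−β_j)`, as the sum of the three residue terms of `Eq1515.core`.
[cite: Zhang2022LandauSiegel, §15 (15.15)–(15.16) p.85] -/
theorem res_sum_eq_sum_calR1 {Φ : ℂ → ℂ} (hχ1 : χ ≠ 1) (hP : 0 < P4 D) {d : ℕ} (hd : 1 ≤ d) (l : ℕ)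
    (hΦ : ∀ s, Φ s = riemannZeta (1 + s + beta1 c' D) * riemannZeta (1 + s + beta2 c' D) *
      calM1 c' χ d l (1 + s) * (d : ℂ) ^ beta3 c' D * s /
      (riemannZeta₁ (1 + s) * χ.LFunction (1 + s)))
    (h10 : beta1 c' D ≠ 0) (h20 : beta2 c' D ≠ 0) (h30 : beta3 c' D ≠ 0)
    (h12 : beta1 c' D ≠ beta2 c' D) (h13 : beta1 c' D ≠ beta3 c' D) (h23 : beta2 c' D ≠ beta3 c' D)
    (hζ1 : riemannZeta (1 - beta1 c' D) ≠ 0) (hζ2 : riemannZeta (1 - beta2 c' D) ≠ 0)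
    (hζ3 : riemannZeta (1 - beta3 c' D) ≠ 0)
    (hL1 : χ.LFunction (1 - beta1 c' D) ≠ 0) (hL2 : χ.LFunction (1 - beta2 c' D) ≠ 0)
    (hL3 : χ.LFunction (1 - beta3 c' D) ≠ 0) :
    riemannZeta₁ (1 + -beta1 c' D + beta1 c' D) * riemannZeta (1 + -beta1 c' D + beta2 c' D) *
          (calM1 c' χ d l (1 + -beta1 c' D) * (d : ℂ) ^ beta3 c' D * -beta1 c' D /
            (riemannZeta₁ (1 + -beta1 c' D) * χ.LFunction (1 + -beta1 c' D))) *
          (((P4 D / d : ℝ) : ℂ) ^ (-beta1 c' D + beta3 c' D) *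
            omega1 (ell D ^ 30) (-beta1 c' D + beta3 c' D)) / (-beta1 c' D + beta3 c' D) +
        riemannZeta₁ (1 + -beta2 c' D + beta2 c' D) * riemannZeta (1 + -beta2 c' D + beta1 c' D) *
          (calM1 c' χ d l (1 + -beta2 c' D) * (d : ℂ) ^ beta3 c' D * -beta2 c' D /
            (riemannZeta₁ (1 + -beta2 c' D) * χ.LFunction (1 + -beta2 c' D))) *
          (((P4 D / d : ℝ) : ℂ) ^ (-beta2 c' D + beta3 c' D) *
            omega1 (ell D ^ 30) (-beta2 c' D + beta3 c' D)) / (-beta2 c' D + beta3 c' D) +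
        Φ (-beta3 c' D) * (((P4 D / d : ℝ) : ℂ) ^ (-beta3 c' D + beta3 c' D) *
          omega1 (ell D ^ 30) (-beta3 c' D + beta3 c' D)) =
      ∑ j ∈ ({1, 2, 3} : Finset ℕ),
        calR1 c' χ j * (d : ℂ) ^ betaJ c' D j * calM1 c' χ d l (1 - betaJ c' D j) := by
  rw [resA_eq_calR1_one c' χ hχ1 hP hd l h10 h12 h13 hζ1 hL1,
    resB_eq_calR1_two c' χ hχ1 hP hd l h20 h12.symm h23 hζ2 hL2,
    resK_eq_calR1_three c' χ hχ1 hP d l hΦ h30 h13.symm h23.symm hζ3 hL3]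
  have hb1 : betaJ c' D 1 = beta1 c' D := by simp [betaJ]
  have hb2 : betaJ c' D 2 = beta2 c' D := by simp [betaJ]
  have hb3 : betaJ c' D 3 = beta3 c' D := by simp [betaJ]
  rw [Finset.sum_insert (by norm_num), Finset.sum_insert (by norm_num), Finset.sum_singleton,
    hb1, hb2, hb3]
  ring

/-! ### The residue at the exceptional zero is polynomially small -/

/-- `ζ` next to its pole along a purely imaginary shift: for `3/4 ≤ ρ ≤ 1`, `Re γ = 0`, `b ≤ ‖γ‖ ≤ 1`
(`b > 0`), `‖ζ(ρ+γ)‖ ≤ M + 1/b` with the tree's rectangle constant `M`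
(`ZetaNearOne.exists_bound_riemannZeta_rect`). [cite: Titchmarsh1986, §2.1 eq. (2.1.16)] -/
theorem norm_zeta_rho_add_le {M : ℝ}
    (hM : ∀ s : ℂ, 1 / 2 ≤ s.re → s.re ≤ 2 → |s.im| ≤ 3 → s ≠ 1 →
      ‖riemannZeta s‖ ≤ M + 1 / ‖s - 1‖)
    {ρ b : ℝ} {γ : ℂ} (hρ0 : 3 / 4 ≤ ρ) (hρ1 : ρ ≤ 1) (hγ : γ.re = 0) (hb : 0 < b) (hbγ : b ≤ ‖γ‖)
    (hγ1 : ‖γ‖ ≤ 1) :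
    ‖riemannZeta ((ρ : ℂ) + γ)‖ ≤ M + 1 / b := by
  have him : ((ρ : ℂ) + γ).im = γ.im := by simp
  have hre : ((ρ : ℂ) + γ).re = ρ := by simp [hγ]
  have hγim : |γ.im| = ‖γ‖ := by
    have h := Complex.norm_eq_sqrt_sq_add_sq γ
    rw [hγ] at h
    rw [h, show (0 : ℝ) ^ 2 + γ.im ^ 2 = γ.im ^ 2 by ring, Real.sqrt_sq_eq_abs]
  have hne : (ρ : ℂ) + γ ≠ 1 := by
    intro h
    have h2 := congrArg Complex.im h
    rw [him, Complex.one_im] at h2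
    have : ‖γ‖ = 0 := by rw [← hγim, h2, abs_zero]
    linarith
  have h1 := hM ((ρ : ℂ) + γ) (by rw [hre]; linarith) (by rw [hre]; linarith)
    (by rw [him, hγim]; linarith) hne
  have hdist : b ≤ ‖(ρ : ℂ) + γ - 1‖ := by
    calc b ≤ ‖γ‖ := hbγ
      _ = |γ.im| := hγim.symm
      _ = |((ρ : ℂ) + γ - 1).im| := by simp
      _ ≤ ‖(ρ : ℂ) + γ - 1‖ := Complex.abs_im_le_norm _
  calc ‖riemannZeta ((ρ : ℂ) + γ)‖ ≤ M + 1 / ‖(ρ : ℂ) + γ - 1‖ := h1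
    _ ≤ M + 1 / b := by gcongr

/-- `|ζ₁(ρ)| ≥ 1/2` for real `ρ < 1` close to `1`: `ζ₁(ρ) − 1 = (ρ−1)(ζ(ρ) − (ρ−1)⁻¹)` and the second
factor is bounded by the tree's constant `M′` on the rectangle (`ZetaClassicalRegion.exists_bound_sub_inv_rect`),
so `(1−ρ)M′ ≤ 1/2` suffices. [cite: Titchmarsh1986, §2.1 eq. (2.1.16)] -/
theorem half_le_norm_zeta1_of_near_one {M' : ℝ}
    (hM' : ∀ s : ℂ, 1 / 2 ≤ s.re → s.re ≤ 2 → |s.im| ≤ 3 → s ≠ 1 →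
      ‖riemannZeta s - 1 / (s - 1)‖ ≤ M')
    {ρ : ℝ} (hρ0 : 3 / 4 ≤ ρ) (hρ1 : ρ < 1) (hρM : (1 - ρ) * M' ≤ 1 / 2) :
    1 / 2 ≤ ‖riemannZeta₁ (ρ : ℂ)‖ := by
  have hne : (ρ : ℂ) ≠ 1 := by
    intro h; have := congrArg Complex.re h; simp at this; linarith
  have hζ0 : riemannZeta₁ (ρ : ℂ) - 1 = ((ρ : ℂ) - 1) * (riemannZeta ρ - 1 / ((ρ : ℂ) - 1)) := by
    have hsub : (ρ : ℂ) - 1 ≠ 0 := sub_ne_zero.mpr hne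
    rw [riemannZeta_eq_inv_sub_mul hne]
    field_simp
  have hb := hM' (ρ : ℂ) (by simp; linarith) (by simp; linarith) (by simp) hne
  have hnorm : ‖riemannZeta₁ (ρ : ℂ) - 1‖ ≤ 1 / 2 := by
    rw [hζ0, norm_mul]
    have h1 : ‖(ρ : ℂ) - 1‖ = 1 - ρ := by
      rw [← Complex.ofReal_one, ← Complex.ofReal_sub, Complex.norm_real, Real.norm_eq_abs,
        abs_of_nonpos (by linarith)]
      ring
    rw [h1]
    calc (1 - ρ) * ‖riemannZeta ↑ρ - 1 / (↑ρ - 1)‖ ≤ (1 - ρ) * M' :=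
          mul_le_mul_of_nonneg_left hb (by linarith)
      _ ≤ 1 / 2 := hρM
  have h := norm_sub_norm_le (1 : ℂ) (riemannZeta₁ (ρ : ℂ))
  rw [norm_one, norm_sub_rev] at h
  linarith

/-- **The residue at `ρ̃ − 1` is an "acceptable error", quantified** (lane currency). There are absolute
`C_ρ ≥ 0` and `δ₀ > 0` such that, for the `ρ − 1`-residue term of `Eq1515.core` at the §15 objects
(`M := ℳ₁(d,l;·)`, `c := d^{β₃}`, `β_a,β_b,β := β₁,β₂,β₃`, `Y := P₄/d ≥ 1`, `Λ := 𝓛³⁰`), whenever `ρ` is a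
simple real zero of `L(s,χ)` with `1 − ρ ≤ δ₀`, `1 − c_L/(log D + log 4) ≤ ρ` and the inverse bound
`‖L(s,χ)⁻¹‖ ≤ C_L(log D + log(|Im s|+4))(1 + ‖s − ρ‖⁻¹)` to the right of `1 − c_L/(log D + log(|Im s|+4))`
(the per-`D` output of `Lemma84.exceptional_package`), and `α/2 ≤ ‖β_j‖ ≤ 1` (`betaJ_size`), `α ≤ 1`,
`𝓛 ≥ 1`, `‖ℳ₁(d,l;ρ)‖ ≤ M_M`: the residue has norm at most
`C_ρ·(C_L + 1)·(log D + log 4)·α⁻³·(1 − ρ)·M_M`. (With `1 − ρ̃ ≤ K𝓛⁻²⁰²²`, `α = π𝓛⁻⁹` and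
`M_M = C·W(d,l)` this is `≪ 𝓛^{28−2022}·W(d,l)`.) [cite: Zhang2022LandauSiegel, §15 (15.15) p.85]
[cite: MontgomeryVaughan2007, Thm 11.4] -/
theorem norm_resRho_1515_le :
    ∃ Cρ δ₀ : ℝ, 0 ≤ Cρ ∧ 0 < δ₀ ∧ δ₀ ≤ 1 / 4 ∧
      ∀ (c' : ℝ) (D : ℕ) (_ : NeZero D) (χ : DirichletCharacter ℂ D) (d l : ℕ)
        (ρ MM cL CL : ℝ),
        χ ≠ 1 → 1 ≤ d → 1 ≤ P4 D / d → 1 ≤ ell D → 0 < alpha D → alpha D ≤ 1 →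
        alpha D / 2 ≤ ‖beta1 c' D‖ → alpha D / 2 ≤ ‖beta2 c' D‖ → alpha D / 2 ≤ ‖beta3 c' D‖ →
        ‖beta1 c' D‖ ≤ 1 → ‖beta2 c' D‖ ≤ 1 → ‖beta3 c' D‖ ≤ 1 →
        ρ < 1 → 1 - ρ ≤ δ₀ → 1 - cL / (Real.log D + Real.log 4) ≤ ρ →
        χ.LFunction ρ = 0 → deriv χ.LFunction ρ ≠ 0 → 0 ≤ CL →
        (∀ s : ℂ, 1 - cL / (Real.log D + Real.log (|s.im| + 4)) ≤ s.re → s ≠ (ρ : ℂ) →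
          χ.LFunction s ≠ 0 ∧
          ‖(χ.LFunction s)⁻¹‖ ≤ CL * (Real.log D + Real.log (|s.im| + 4)) * (1 + ‖s - ρ‖⁻¹)) →
        ‖calM1 c' χ d l ρ‖ ≤ MM →
        ‖riemannZeta (1 + ((ρ - 1 : ℝ) : ℂ) + beta1 c' D) * riemannZeta (1 + ((ρ - 1 : ℝ) : ℂ) + beta2 c' D) *
            (calM1 c' χ d l (1 + ((ρ - 1 : ℝ) : ℂ)) * (d : ℂ) ^ beta3 c' D * ((ρ - 1 : ℝ) : ℂ) /
              (riemannZeta₁ (1 + ((ρ - 1 : ℝ) : ℂ)) *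
                dslope (fun w => χ.LFunction w) ρ (1 + ((ρ - 1 : ℝ) : ℂ)))) *
            (((P4 D / d : ℝ) : ℂ) ^ (((ρ - 1 : ℝ) : ℂ) + beta3 c' D) *
              omega1 (ell D ^ 30) (((ρ - 1 : ℝ) : ℂ) + beta3 c' D) /
              (((ρ - 1 : ℝ) : ℂ) + beta3 c' D))‖ ≤
          Cρ * (CL + 1) * (Real.log D + Real.log 4) * (alpha D)⁻¹ ^ 3 * (1 - ρ) * MM := by
  obtain ⟨M, hM0, hM⟩ := ZetaNearOne.exists_bound_riemannZeta_rect
  obtain ⟨M', hM'0, hM'⟩ := ZetaClassicalRegion.exists_bound_sub_inv_rect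
  refine ⟨16 * Real.exp 1 * (M + 2) ^ 2, min (1 / 4) (1 / (2 * (M' + 1))), by positivity,
    lt_min (by norm_num) (by positivity), min_le_left _ _, ?_⟩
  intro c' D _ χ d l ρ MM cL CL hχ1 hd hY hℓ hα hα1 hb1 hb2 hb3 hb1' hb2' hb3' hρ1 hρδ hρc hρL hρL'
    hCL hpk hMM
  have hre1 : (beta1 c' D).re = 0 := by simp [beta1]
  have hre2 : (beta2 c' D).re = 0 := by simp [beta2]
  have hre3 : (beta3 c' D).re = 0 := by simp [beta3]
  have hρδ4 : 1 - ρ ≤ 1 / 4 := hρδ.trans (min_le_left _ _)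
  have hρ34 : 3 / 4 ≤ ρ := by linarith
  have hlog4 : 0 < Real.log 4 := Real.log_pos (by norm_num)
  have hlogD : 0 ≤ Real.log D := Real.log_natCast_nonneg D
  have hLL : 0 < Real.log D + Real.log 4 := by linarith
  -- `ζ` at `ρ + β₁`, `ρ + β₂`
  have hZa : ‖riemannZeta ((ρ : ℂ) + beta1 c' D)‖ ≤ M + 1 / (alpha D / 2) :=
    norm_zeta_rho_add_le hM hρ34 hρ1.le hre1 (by positivity) hb1 hb1'
  have hZb : ‖riemannZeta ((ρ : ℂ) + beta2 c' D)‖ ≤ M + 1 / (alpha D / 2) :=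
    norm_zeta_rho_add_le hM hρ34 hρ1.le hre2 (by positivity) hb2 hb2'
  -- `ζ₁(ρ) ≥ 1/2`
  have hζ1 : 1 / 2 ≤ ‖riemannZeta₁ (ρ : ℂ)‖ := by
    refine half_le_norm_zeta1_of_near_one hM' hρ34 hρ1 ?_
    have h1 : 1 - ρ ≤ 1 / (2 * (M' + 1)) := hρδ.trans (min_le_right _ _)
    calc (1 - ρ) * M' ≤ 1 / (2 * (M' + 1)) * M' :=
          mul_le_mul_of_nonneg_right h1 hM'0
      _ ≤ 1 / 2 := by
          rw [div_mul_eq_mul_div, div_le_iff₀ (by positivity)]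
          nlinarith
  -- `‖c‖ = 1`
  have hcst : ‖(d : ℂ) ^ beta3 c' D‖ ≤ 1 := by
    rw [Complex.norm_natCast_cpow_of_pos (by omega), hre3, Real.rpow_zero]
  -- the floor for `L′(ρ)`
  set ΛL : ℝ := (CL + 1) * (Real.log D + Real.log 4) with hΛL
  have hΛL0 : 0 < ΛL := by positivity
  have hfloor : ∀ s : ℝ, ρ < s → s < ρ + 1 →
      χ.LFunction s ≠ 0 ∧ ‖(χ.LFunction s)⁻¹‖ ≤ ΛL * (1 + |s - ρ|⁻¹) := by
    intro s hs1 hs2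
    have hsre : 1 - cL / (Real.log D + Real.log (|((s : ℂ)).im| + 4)) ≤ ((s : ℂ)).re := by
      simp only [Complex.ofReal_im, abs_zero, zero_add, Complex.ofReal_re]
      linarith
    have hsne : (s : ℂ) ≠ (ρ : ℂ) := by
      intro h; have := Complex.ofReal_inj.mp h; linarith
    obtain ⟨hne, hbd⟩ := hpk (s : ℂ) hsre hsne
    refine ⟨hne, hbd.trans ?_⟩
    have hsρ : ‖(s : ℂ) - ρ‖ = |s - ρ| := by
      rw [← Complex.ofReal_sub, Complex.norm_real, Real.norm_eq_abs]
    simp only [Complex.ofReal_im, abs_zero, zero_add]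
    rw [hsρ]
    have h1 : 0 ≤ 1 + |s - ρ|⁻¹ := by positivity
    have hle : CL * (Real.log D + Real.log 4) ≤ (CL + 1) * (Real.log D + Real.log 4) := by
      nlinarith
    exact mul_le_mul_of_nonneg_right hle h1
  have hinv : ‖(deriv χ.LFunction ρ)⁻¹‖ ≤ ΛL :=
    Eq1610.norm_inv_deriv_le_of_inv_bound χ hΛL0 one_pos hρL
      (DirichletCharacter.differentiable_LFunction hχ1).differentiableAt hρL' hfloor
  have hLmin : 1 / ΛL ≤ ‖deriv χ.LFunction ρ‖ := by
    have hpos : 0 < ‖deriv χ.LFunction ρ‖ := norm_pos_iff.mpr hρL'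
    rw [norm_inv] at hinv
    rw [div_le_iff₀ hΛL0]
    calc 1 = ‖deriv χ.LFunction ↑ρ‖⁻¹ * ‖deriv χ.LFunction ↑ρ‖ := by
          rw [inv_mul_cancel₀ hpos.ne']
      _ ≤ ΛL * ‖deriv χ.LFunction ↑ρ‖ := mul_le_mul_of_nonneg_right hinv hpos.le
      _ = ‖deriv χ.LFunction ↑ρ‖ * ΛL := by ring
  -- the distance from `ρ − 1` to `−β₃`
  have hbmin : alpha D / 2 ≤ ‖((ρ - 1 : ℝ) : ℂ) + beta3 c' D‖ := by
    have hγim : |(beta3 c' D).im| = ‖beta3 c' D‖ := by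
      have h := Complex.norm_eq_sqrt_sq_add_sq (beta3 c' D)
      rw [hre3] at h
      rw [h, show (0 : ℝ) ^ 2 + (beta3 c' D).im ^ 2 = (beta3 c' D).im ^ 2 by ring,
        Real.sqrt_sq_eq_abs]
    calc alpha D / 2 ≤ ‖beta3 c' D‖ := hb3
      _ = |(beta3 c' D).im| := hγim.symm
      _ = |(((ρ - 1 : ℝ) : ℂ) + beta3 c' D).im| := by simp
      _ ≤ ‖((ρ - 1 : ℝ) : ℂ) + beta3 c' D‖ := Complex.abs_im_le_norm _
  -- `(1−ρ)² ≤ 4Λ`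
  have hΛ : (0 : ℝ) < ell D ^ 30 := by positivity
  have hρΛ : (1 - ρ) ^ 2 ≤ 4 * ell D ^ 30 := by
    have h1 : (1 - ρ) ^ 2 ≤ 1 := by nlinarith
    have h2 : (1 : ℝ) ≤ ell D ^ 30 := one_le_pow₀ hℓ
    linarith
  -- the abstract size lemma
  have key := norm_resRho_le χ (calM1 c' χ d l) ((d : ℂ) ^ beta3 c' D) (beta1 c' D) (beta2 c' D)
    (beta3 c' D) (P4 D / d) (ell D ^ 30) hΛ hY hρ1.le hre3 hZa hZb hMM hcst hζ1
    (one_div_pos.mpr hΛL0) hLmin (half_pos hα) hbmin hρΛ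
  refine key.trans ?_
  -- arithmetic: `(M + 2/α)²·MM·(1−ρ)·(2ΛL)·(2e/α) = 4e(M+2/α)²·ΛL·α⁻¹·(1−ρ)·MM ≤ 16e(M+2)²·ΛL·α⁻³·(1−ρ)·MM`
  have hMM0 : 0 ≤ MM := (norm_nonneg _).trans hMM
  have hρ0 : 0 ≤ 1 - ρ := by linarith
  have hαinv : 1 ≤ (alpha D)⁻¹ := (one_le_inv₀ hα).mpr hα1
  have hαinv0 : 0 ≤ (alpha D)⁻¹ := by positivity
  have e1 : 1 / (alpha D / 2) = 2 * (alpha D)⁻¹ := by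
    field_simp
  have e2 : 2 / (1 / ΛL) = 2 * ΛL := by
    field_simp
  have e3 : Real.exp 1 / (alpha D / 2) = 2 * Real.exp 1 * (alpha D)⁻¹ := by
    field_simp
  rw [e1, e2, e3]
  have hZ : M + 2 * (alpha D)⁻¹ ≤ (M + 2) * (alpha D)⁻¹ := by
    have h1 : M * 1 ≤ M * (alpha D)⁻¹ := mul_le_mul_of_nonneg_left hαinv hM0
    have h2 : (M + 2) * (alpha D)⁻¹ = M * (alpha D)⁻¹ + 2 * (alpha D)⁻¹ := by ring
    rw [h2]
    linarith only [h1]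
  have hZ0 : 0 ≤ M + 2 * (alpha D)⁻¹ := by positivity
  have hsq : (M + 2 * (alpha D)⁻¹) ^ 2 ≤ ((M + 2) * (alpha D)⁻¹) ^ 2 :=
    pow_le_pow_left₀ hZ0 hZ 2
  have hrest : 0 ≤ ΛL * (alpha D)⁻¹ * (1 - ρ) * MM := by positivity
  calc (M + 2 * (alpha D)⁻¹) * (M + 2 * (alpha D)⁻¹) * MM * (1 - ρ) * (2 * ΛL) *
        (2 * Real.exp 1 * (alpha D)⁻¹)
      = 4 * Real.exp 1 * (M + 2 * (alpha D)⁻¹) ^ 2 * (ΛL * (alpha D)⁻¹ * (1 - ρ) * MM) := by ring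
    _ ≤ 4 * Real.exp 1 * ((M + 2) * (alpha D)⁻¹) ^ 2 * (ΛL * (alpha D)⁻¹ * (1 - ρ) * MM) := by
        gcongr
    _ ≤ 16 * Real.exp 1 * ((M + 2) * (alpha D)⁻¹) ^ 2 * (ΛL * (alpha D)⁻¹ * (1 - ρ) * MM) := by
        have h0 : 0 ≤ Real.exp 1 * ((M + 2) * (alpha D)⁻¹) ^ 2 * (ΛL * (alpha D)⁻¹ * (1 - ρ) * MM) := by
          positivity
        linarith only [h0]
    _ = 16 * Real.exp 1 * (M + 2) ^ 2 * (CL + 1) * (Real.log D + Real.log 4) *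
          (alpha D)⁻¹ ^ 3 * (1 - ρ) * MM := by rw [hΛL]; ring

end Literature.NumberTheory.LFunctions.Zhang2022.Eq1515
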